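import Literature.NumberTheory.LFunctions.KMVDiagOnlyClosesLeaf
import Literature.NumberTheory.LFunctions.KMVMomentsToHalfEdgePB
import HarnessLib

/-!
# famE-02's diagonal-only form closes the leaf — RE-THREADED to the Petersson bound in its printed range
# (`kowalskiMichel2000_peterssonBound`; twins of `KMVDiagOnlyClosesLeaf`)

Topic `Literature/NumberTheory/LFunctions` (namespace `Literature.NumberTheory.LFunctions.KMV2000`, as the original).
PROOFS only — no definition, no named fact (D-0026). Cell landau-siegel, D-0124 rescue W1 event R2-G44 (director-frontier
2026-08-27 11:41:46Z / 11:56:05Z, re-thread file F7 = HP-CARRIERS rows #26–#27), typer seat ls-rescue-typ-1.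

WHY. `KowalskiMichel2000.kowalskiMichel2000_petersson` (Kowalski–Michel 2000 p. 310 typed for ALL `m, n ≥ 1`) is FALSE AS
TYPED (`KowalskiMichel2000.not_kowalskiMichel2000_petersson`, Atkin–Lehner at `(q,q)`); the print is fine; the repaired fact
of record is `KowalskiMichel2000.kowalskiMichel2000_peterssonBound` (extra binder `¬ (q ∣ m ∧ q ∣ n)`). The two theorems
of `KMVDiagOnlyClosesLeaf` carrying `(hP : kowalskiMichel2000_petersson)` get ADDITIVE twins `…_pb` with the binder
`(hP : KowalskiMichel2000.kowalskiMichel2000_peterssonBound)`, statements otherwise IDENTICAL, proofs = the originals with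
the consumed hP-theorems replaced by their landed twins:
`CentralValueFamilyHalfEdge.primeLevelFamilyTwo_EStarFam_of_beyondDiagonalValue_pb` (`KMVMomentsToHalfEdgePB`) and the
four-fact leaf glue `CentralValueFamilyHalfEdge.lOne_lowerBound_of_EStarFam_prime_weightTwo'_pb`
(`IwaniecSarnakFamilyWeightTwoPeterssonPB`). Pass-through only: no instantiation of the Petersson bound happens in this
file. Originals untouched; nothing here uses `¬ kowalskiMichel2000_petersson` (no ex falso — smuggling rule).
«refuted-as-typed ≠ refuted-in-print» · «The programme SEARCHES and TYPES; no claim about Landau–Siegel zeros,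
Theorems 1–2 of arXiv:2211.02515 or a repaired Margin232 until a kernel theorem says so.»

## References

* [KowalskiMichelVanderKam2000] E. Kowalski, P. Michel, J. VanderKam, J. reine angew. Math. 526 (2000): Thm. 6.1 (32),
  §6 p. 19, Prop. 5.1.
* [IwaniecConversations2006] H. Iwaniec, LNM 1891 (2006), §7 (7.5)–(7.7), p. 97.
* [KowalskiMichel2000] E. Kowalski, P. Michel, Acta Arith. 94 (2000), §2.3 p. 310 (display after (16)).
* Tree: `KMVDiagOnlyClosesLeaf` (original), `KMVMomentsToHalfEdgePB`, `IwaniecSarnakFamilyWeightTwoPeterssonPB` (p531367).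
-/

noncomputable section

namespace Literature.NumberTheory.LFunctions.KMV2000

open Polynomial

/-- **famE-02's diagonal-only placeholder on one window beyond the diagonal + the two printed facts of the conversion
(Petersson IN ITS RANGE) ⇒ `E*-fam` past one half** at prime level, weight `2` — twin of `eStarFam_of_diagOnly`.
[cite: KowalskiMichelVanderKam2000, Thm. 6.1 (32); §6 p. 19] [cite: IwaniecConversations2006, §7 (7.5)] -/
theorem eStarFam_of_diagOnly_pb {Δ₀ : ℝ} (hΔ₀ : 1 < Δ₀) (hD : MomentAsymptoticsDiagOnly 1 Δ₀)
    (hLR : IwaniecSarnak.lapidRallis2003_theorem1_gl2Twist)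
    (hP : KowalskiMichel2000.kowalskiMichel2000_peterssonBound) :
    ∃ p₁ : ℝ, 1 / 2 < p₁ ∧ CentralValueFamilyHalfEdge.primeLevelFamilyTwo.EStarFam p₁ 2 := by
  obtain ⟨b, hb1, hbΔ, P, hPadm, hval⟩ := beatsQuarter_of_diagOnly hΔ₀ hD Δ₀ hΔ₀ _ _ hD
  exact CentralValueFamilyHalfEdge.primeLevelFamilyTwo_EStarFam_of_beyondDiagonalValue_pb hLR hP Δ₀
    hΔ₀ _ _ hD b hb1 hbΔ P hPadm hval

/-- **… hence the F-S3 leaf `Zhang2022.Skeleton.Theorem1`** — twin of `skeletonTheorem1_of_diagOnly` with the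
Petersson input in its printed range: `E*-fam(p₁ > ½)` ⇒ `L(1,χ_D) ≫ (log D)⁻⁴` eventually
(`lOne_lowerBound_of_EStarFam_prime_weightTwo'_pb`) ⇒ `LOneLowerBound 4` ⇒ (`4 ≤ 2022`) `Theorem1`. An implication from
four displayed printed facts and the diagonal-only placeholder; asserts none of them.
[cite: IwaniecConversations2006, §7 (7.7) and p. 97] -/
theorem skeletonTheorem1_of_diagOnly_pb {Δ₀ : ℝ} (hΔ₀ : 1 < Δ₀) (hD : MomentAsymptoticsDiagOnly 1 Δ₀)
    (hLR : IwaniecSarnak.lapidRallis2003_theorem1_gl2Twist)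
    (hTw : IwaniecSarnak.iwaniec2006_twistedHalf)
    (hMix : IwaniecSarnak.iwaniec2006_mixedMomentOverMass)
    (hP : KowalskiMichel2000.kowalskiMichel2000_peterssonBound) :
    Zhang2022.Skeleton.Theorem1 := by
  obtain ⟨p₁, hp, hE⟩ := eStarFam_of_diagOnly_pb hΔ₀ hD hLR hP
  have h4 : Zhang2022.Skeleton.LOneLowerBound 4 := by
    refine CentralValueFamilyHalfEdge.lOneLowerBound_of_eventual ?_
    obtain ⟨c, hc, D₀, h⟩ :=
      CentralValueFamilyHalfEdge.lOne_lowerBound_of_EStarFam_prime_weightTwo'_pb hLR hTw hMix hP hp hE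
    exact ⟨c, hc, D₀, fun D _ χ hD hprim hquad ↦ h D χ hD hprim hquad⟩
  exact Zhang2022.Section1.lOneLowerBound_mono (by norm_num) h4

end Literature.NumberTheory.LFunctions.KMV2000
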